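import Summits.QuantumFields.YangMills.Theorems.UnitScaleTiltProp7NestedMeanParallelLiftParSplit
import HarnessLib

/-!
# S2β ∕ GAP♯∘ — THE TWO ANALYTIC STRATA ARE GAUGE-INVARIANT CLASSES: the `hGinv` letter of LEAD w3 g29's ✓p838715 `hsupp_floor_of_sqrtGauge (G) (hGinv) …`
# DISCHARGED at `G := G_IRR` («every parallel section is scalar») and at `G := G_A′` («a gauge copy is `σ₃`-diagonal with constant-diagonal parallel sections»)

Cell `ym3-torus` (YM ladder rung R3 = continuum `SU(2)` Yang–Mills on the three-torus — a RUNG: NOT d = 4, NOT infinite volume, NOT a mass gap, NOT Clay).  Width seat `ym-ust-20520-w5`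
(gen 28), helper on crux `stmt-QuantumFields-20520`, LINE g18-1 S2β; `--kind proof --supports stmt-QuantumFields-20520 --as helper`, count-neutral, DEFINITION-FREE (0 `def`, 0 `instance`,
0 `notation`, 0 `sorry`), default heartbeats.

WHY (desk RULING №123 gap list «`hGinv` ×2 (names, px12∕px8?)»; planner RULING №120 ∕ (BG∞) plan of record UV3-NODE §116).  After the height floor, the one open supplier of the floored
GAP♯∘ road is the class-free small-bond gauge letter `hBG` («`arc ≤ C·√θ + c∕N_J`»), which ✓p838715 turns into the FLOORED `hsupp` of ✓p838180 at `G′ := G ∧ G_{s₀}` for any GAUGE-INVARIANT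
class `G`.  The two classes the strata assembly (✓`uniformFibreGapOrbit_of_strata(_floor)`) consumes are the IRREDUCIBLE stratum `G_IRR` and the case-A′ stratum `G_A′` of
✓`irr_or_caseA_or_loopHol_central`; THIS FILE proves both are gauge-invariant, in EXACTLY ✓p838715's `hGinv` binder shape, so that `hsupp_floor_of_sqrtGauge ⟨G_IRR⟩ irrStratum_gaugeAct`
and `hsupp_floor_of_sqrtGauge ⟨G_A′⟩ abelianStratum_gaugeAct` are closed partial applications.  PROOFS ([folklore] gauge covariance): (IRR) a `(u • V)`-parallel section `c` conjugates to the
`V`-parallel section `c′ y := (u y)⋆ · c y · u y` (✓`parallel_iff_star` + unitarity), which is scalar by hypothesis, hence so is `c`; (A′) the witness gauge `g` for `V` becomes `g · u⁻¹` for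
`u • V` (`(g·u⁻¹) • (u • V) = g • V`, pointwise group algebra), after which the body is literally the hypothesis.

WHAT IS PROVED (sorry-free).  ★ `irrStratum_gaugeAct`, ★ `abelianStratum_gaugeAct` — each `∀ (F) (J) (u) (V), G F J V → G F J (GaugeField.gaugeAct u V)` at the stratum's text (the texts
of ✓p836047's `hD₁`∕`hD₂` guards ∕ ✓`uniformFibreGapOrbit_of_strata`'s `hIrr`∕`hA` guards, byte for byte).

HONEST SCOPE.  Two elementary gauge-covariance lemmas; nothing of Bałaban's analysis is asserted or proved ([Balaban1985Averaging] (8)–(9) p.19 — gauge transformations and their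
action; [Balaban1985Variational] (4) p.278 «𝔘_k is gauge invariant»); `hBG` (the (BG∞) supplier) is a CONJECTURE of the lane, untouched here; GAP♯∘ (`stub_uniformFibreGapOrbit`, registry
v11 on the tree, v12.1 adopted-not-written; 0∕5), S2β, crux 20520, 19936, 19200 and `YM3TorusSU2` are NOT proved; no registered stub is closed; rung R3 — NOT d = 4, NOT infinite volume,
NOT a mass gap, NOT Clay; the Yang–Mills mass gap is NOT proved.
-/

set_option autoImplicit false

noncomputable section

open scoped Matrix.Norms.L2Operator Matrix
open Literature.MathematicalPhysics.QuantumFieldTheory.Balaban1983to89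
open Literature.MathematicalPhysics.QuantumFieldTheory.Balaban1983to89.T4Continuum
open Literature.MathematicalPhysics.QuantumFieldTheory.Balaban1983to89.T3ContinuumYM3Torus
open Literature.MathematicalPhysics.QuantumFieldTheory.Balaban1983to89.B10Eq27TorusAxialLog (unitsField toUField)
open Literature.MathematicalPhysics.QuantumFieldTheory.Balaban1983to89.B9AdOrthogonal (σ₃)
open Summit.QuantumFields.YangMills.Theorems.Prop7NestedMeanParallelLiftDiagGauge (parallel_iff_star)

namespace Summit.QuantumFields.YangMills.Theorems.FluctuationComparisonRegPrIntLS2BetaStrataGaugeInvariant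

/-- The matrix of an `SU(2)` element is unitary: `A⋆·A = 1`. [folklore] -/
theorem star_coe_mul_coe (A : Matrix.specialUnitaryGroup (Fin 2) ℂ) :
    star (A : Matrix (Fin 2) (Fin 2) ℂ) * (A : Matrix (Fin 2) (Fin 2) ℂ) = 1 :=
  Matrix.mem_unitaryGroup_iff'.1 (Matrix.mem_specialUnitaryGroup_iff.1 A.2).1

/-- The matrix of an `SU(2)` element is unitary: `A·A⋆ = 1`. [folklore] -/
theorem coe_mul_star_coe (A : Matrix.specialUnitaryGroup (Fin 2) ℂ) :
    (A : Matrix (Fin 2) (Fin 2) ℂ) * star (A : Matrix (Fin 2) (Fin 2) ℂ) = 1 :=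
  Matrix.mem_unitaryGroup_iff.1 (Matrix.mem_specialUnitaryGroup_iff.1 A.2).1

/-- The matrix of a gauged bond variable: `↑((u • V) e) = ↑(u e₋) · ↑(V e) · (↑(u e₊))⋆`. [cite: Balaban1985Averaging, (8) p.19] -/
theorem coe_gaugeAct_apply {P : Params} (u : GaugeTransf P 0 (Matrix.specialUnitaryGroup (Fin 2) ℂ))
    (V : GaugeField P 0 (Matrix.specialUnitaryGroup (Fin 2) ℂ)) (e : PBond P 0) :
    ((GaugeField.gaugeAct u V e : Matrix.specialUnitaryGroup (Fin 2) ℂ) : Matrix (Fin 2) (Fin 2) ℂ) =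
      (u e.src : Matrix (Fin 2) (Fin 2) ℂ) * (V e : Matrix (Fin 2) (Fin 2) ℂ) * star (u e.tgt : Matrix (Fin 2) (Fin 2) ℂ) := by
  simp only [GaugeField.gaugeAct, ← Matrix.star_eq_inv, Submonoid.coe_mul, Matrix.specialUnitaryGroup.coe_star]

/-- ★ **THE IRREDUCIBLE STRATUM IS GAUGE-INVARIANT** («every `V`-parallel matrix section is scalar» ⇒ the same for `u • V`), in ✓p838715's `hGinv` shape at `G := G_IRR`.
[cite: Balaban1985Averaging, (8)-(9) p.19; Balaban1985Variational, (4) p.278] -/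
theorem irrStratum_gaugeAct :
    ∀ (F : T3Family) (J : ℕ) (u : GaugeTransf (F.P J) 0 (Matrix.specialUnitaryGroup (Fin 2) ℂ))
      (V : GaugeField (F.P J) 0 (Matrix.specialUnitaryGroup (Fin 2) ℂ)),
      (∀ c : Site (F.P J) 0 → Matrix (Fin 2) (Fin 2) ℂ,
          (∀ e : PBond (F.P J) 0, c e.src = ((unitsField (toUField V) e : (Matrix (Fin 2) (Fin 2) ℂ)ˣ) : Matrix (Fin 2) (Fin 2) ℂ) * c e.tgt *
            (((unitsField (toUField V) e)⁻¹ : (Matrix (Fin 2) (Fin 2) ℂ)ˣ) : Matrix (Fin 2) (Fin 2) ℂ)) →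
          ∃ z : ℂ, ∀ y, c y = z • (1 : Matrix (Fin 2) (Fin 2) ℂ)) →
      (∀ c : Site (F.P J) 0 → Matrix (Fin 2) (Fin 2) ℂ,
          (∀ e : PBond (F.P J) 0, c e.src = ((unitsField (toUField (GaugeField.gaugeAct u V)) e : (Matrix (Fin 2) (Fin 2) ℂ)ˣ) : Matrix (Fin 2) (Fin 2) ℂ) * c e.tgt *
            (((unitsField (toUField (GaugeField.gaugeAct u V)) e)⁻¹ : (Matrix (Fin 2) (Fin 2) ℂ)ˣ) : Matrix (Fin 2) (Fin 2) ℂ)) →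
          ∃ z : ℂ, ∀ y, c y = z • (1 : Matrix (Fin 2) (Fin 2) ℂ)) := by
  intro F J u V hirr c hc
  -- the hypothesis in adjoint form: `c e₋ = ↑((u•V) e) · c e₊ · (↑((u•V) e))⋆`
  have hcs : ∀ e : PBond (F.P J) 0, c e.src =
      ((GaugeField.gaugeAct u V e : Matrix.specialUnitaryGroup (Fin 2) ℂ) : Matrix (Fin 2) (Fin 2) ℂ) * c e.tgt *
        star ((GaugeField.gaugeAct u V e : Matrix.specialUnitaryGroup (Fin 2) ℂ) : Matrix (Fin 2) (Fin 2) ℂ) :=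
    fun e => (parallel_iff_star (GaugeField.gaugeAct u V) c e).1 (hc e)
  -- the conjugated section `c′ y := (u y)⋆ · c y · u y` is `V`-parallel
  set c' : Site (F.P J) 0 → Matrix (Fin 2) (Fin 2) ℂ :=
    fun y => star (u y : Matrix (Fin 2) (Fin 2) ℂ) * c y * (u y : Matrix (Fin 2) (Fin 2) ℂ) with hc'def
  have hc' : ∀ e : PBond (F.P J) 0, c' e.src = ((unitsField (toUField V) e : (Matrix (Fin 2) (Fin 2) ℂ)ˣ) : Matrix (Fin 2) (Fin 2) ℂ) * c' e.tgt *
        (((unitsField (toUField V) e)⁻¹ : (Matrix (Fin 2) (Fin 2) ℂ)ˣ) : Matrix (Fin 2) (Fin 2) ℂ) := by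
    intro e
    rw [parallel_iff_star V c' e, hc'def]
    simp only
    rw [hcs e, coe_gaugeAct_apply]
    simp only [star_mul, star_star, mul_assoc]
    rw [star_coe_mul_coe, mul_one, ← mul_assoc (star (u e.src : Matrix (Fin 2) (Fin 2) ℂ)), star_coe_mul_coe, one_mul]
  obtain ⟨z, hz⟩ := hirr c' hc'
  refine ⟨z, fun y => ?_⟩
  have hy : star (u y : Matrix (Fin 2) (Fin 2) ℂ) * c y * (u y : Matrix (Fin 2) (Fin 2) ℂ) = z • (1 : Matrix (Fin 2) (Fin 2) ℂ) := hz y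
  -- `c y = u y · (z • 1) · (u y)⋆ = z • 1`
  calc c y = (u y : Matrix (Fin 2) (Fin 2) ℂ) * (star (u y : Matrix (Fin 2) (Fin 2) ℂ) * c y * (u y : Matrix (Fin 2) (Fin 2) ℂ)) *
        star (u y : Matrix (Fin 2) (Fin 2) ℂ) := by
          simp only [mul_assoc]
          rw [coe_mul_star_coe, mul_one, ← mul_assoc, coe_mul_star_coe, one_mul]
    _ = z • (1 : Matrix (Fin 2) (Fin 2) ℂ) := by
          rw [hy, Matrix.mul_smul, Matrix.mul_one, Matrix.smul_mul, coe_mul_star_coe]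

/-- ★ **THE CASE-A′ STRATUM IS GAUGE-INVARIANT** («some gauge copy of `V` is `σ₃`-diagonal with constant `σ₃`-commuting parallel sections» ⇒ the same for `u • V`, with the gauge
`g · u⁻¹`), in ✓p838715's `hGinv` shape at `G := G_A′`. [cite: Balaban1985Averaging, (8)-(9) p.19; Balaban1985Variational, (4) p.278] -/
theorem abelianStratum_gaugeAct :
    ∀ (F : T3Family) (J : ℕ) (u : GaugeTransf (F.P J) 0 (Matrix.specialUnitaryGroup (Fin 2) ℂ))
      (V : GaugeField (F.P J) 0 (Matrix.specialUnitaryGroup (Fin 2) ℂ)),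
      (∃ g : GaugeTransf (F.P J) 0 (Matrix.specialUnitaryGroup (Fin 2) ℂ),
          (∀ e : PBond (F.P J) 0, Commute (((GaugeField.gaugeAct g V) e : Matrix.specialUnitaryGroup (Fin 2) ℂ) : Matrix (Fin 2) (Fin 2) ℂ) σ₃) ∧
          ∀ c : Site (F.P J) 0 → Matrix (Fin 2) (Fin 2) ℂ,
            (∀ e : PBond (F.P J) 0, c e.src = ((unitsField (toUField (GaugeField.gaugeAct g V)) e : (Matrix (Fin 2) (Fin 2) ℂ)ˣ) : Matrix (Fin 2) (Fin 2) ℂ) * c e.tgt *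
            (((unitsField (toUField (GaugeField.gaugeAct g V)) e)⁻¹ : (Matrix (Fin 2) (Fin 2) ℂ)ˣ) : Matrix (Fin 2) (Fin 2) ℂ)) →
            ∃ c₀ : Matrix (Fin 2) (Fin 2) ℂ, (∀ y, c y = c₀) ∧ Commute c₀ σ₃) →
      (∃ g : GaugeTransf (F.P J) 0 (Matrix.specialUnitaryGroup (Fin 2) ℂ),
          (∀ e : PBond (F.P J) 0, Commute (((GaugeField.gaugeAct g (GaugeField.gaugeAct u V)) e : Matrix.specialUnitaryGroup (Fin 2) ℂ) : Matrix (Fin 2) (Fin 2) ℂ) σ₃) ∧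
          ∀ c : Site (F.P J) 0 → Matrix (Fin 2) (Fin 2) ℂ,
            (∀ e : PBond (F.P J) 0, c e.src = ((unitsField (toUField (GaugeField.gaugeAct g (GaugeField.gaugeAct u V))) e : (Matrix (Fin 2) (Fin 2) ℂ)ˣ) : Matrix (Fin 2) (Fin 2) ℂ) * c e.tgt *
            (((unitsField (toUField (GaugeField.gaugeAct g (GaugeField.gaugeAct u V))) e)⁻¹ : (Matrix (Fin 2) (Fin 2) ℂ)ˣ) : Matrix (Fin 2) (Fin 2) ℂ)) →
            ∃ c₀ : Matrix (Fin 2) (Fin 2) ℂ, (∀ y, c y = c₀) ∧ Commute c₀ σ₃) := by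
  intro F J u V h
  obtain ⟨g, hg⟩ := h
  refine ⟨fun x => g x * (u x)⁻¹, ?_⟩
  have hgu : GaugeField.gaugeAct (fun x => g x * (u x)⁻¹) (GaugeField.gaugeAct u V) = GaugeField.gaugeAct g V := by
    funext b
    simp only [GaugeField.gaugeAct, mul_inv_rev, inv_inv, mul_assoc, inv_mul_cancel_left]
  rw [hgu]
  exact hg

end Summit.QuantumFields.YangMills.Theorems.FluctuationComparisonRegPrIntLS2BetaStrataGaugeInvariant

end
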